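import Literature.MathematicalPhysics.QuantumLattice.PeriodicLayeredLatticeBilayerCell
import HarnessLib

/-!
# The U-DRESSED interlayer floor of a bilayer crystal: the intra-bilayer bonds are disjoint Hubbard
# DIMERS, so `e_ρ(one-band, U − W) + ½·(a + 2bρ) − |t⊥'| ≤ inf_{periodic, filling ρ} e(bilayer crystal)`
# for every affine minorant `a + b k ≤ E₀(h_dimer(t⊥, W), k)` of the dimer's sector ground energies

Topic `Literature/MathematicalPhysics/QuantumLattice` (namespace = path; family `hubbard`). Sequel of
`PeriodicLayeredLatticeEnergyTransport.lean` (period-`2` stacking on `ℤ^{d+1}`: intra-bilayer vertical bonds of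
amplitude `t⊥` from the EVEN layers, inter-bilayer bonds `t⊥'` from the ODD layers; its floor charges the KINEMATIC
allowance `|t⊥| + |t⊥'|` per site) and of `PeriodicLayeredLatticeBilayerCell.lean` (the bookkeeping: `U`-split, the
period-2 cell, the intra-bilayer pattern reads one bond, the dimer's expectation and particle number); the interlayer twin
of `HubbardTTPrimeTPPDoublingUAnchors.lean` (the `U`-dressed third-neighbour law). Written for the S1/S2 interlayer seam of
the Hubbard material-oracle programme (bilayer cuprates: the S1 boxes print `t⊥/t ∈ [0.3, 0.45]` for YBa₂Cu₃O₇, `≤ 0.21` for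
Hg-1223; the seam `Downfold/TperpSeam.holdsOn_bilayerHubbardTTPrime_of_window` charges `2·max|t⊥/t|`).

THE ARGUMENT (Anderson's cluster decomposition for the vertical part, with repulsion). Split the on-site coupling
`U = (U − W) + W`. The cell energy of a period-`2` periodic state `ω` is (i) the cell energy of the in-plane model at
`U − W` — floored by the one-band fixed-filling ground-state energy density `e_ρ(U − W)` exactly as in the parent — plus
(ii) `W·D̄(ω) + t⊥·K⊥(ω) + t⊥'·K⊥'(ω)` (`D̄` the cell-averaged double occupancy, `K⊥`, `K⊥'` the cell energies of the two
vertical bond patterns). By the bookkeeping file `W·D̄ + t⊥·K⊥ = ½·Re ω(h)` with `h` the Hubbard DIMER Hamiltonian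
`W(n_{0↑}n_{0↓} + n_{e₀↑}n_{e₀↓}) − t⊥ Σ_σ(c†_0 c_{e₀} + h.c.)` on the region `{0, e₀}`. Ruelle's sector decomposition
(`HubbardStateSectorDecomposition`) gives `Re ω(h) ≥ Σ_N Re ω(P_N)·E₀(h, N)` with `Σ_N Re ω(P_N) = 1`,
`Σ_N N·Re ω(P_N) = ρ_0(ω) + ρ_{e₀}(ω) = 2ρ̄(ω)`; so every affine minorant `a + b k ≤ E₀(h, k)` (`k ≤ 4`) yields
`W·D̄ + t⊥·K⊥ ≥ ½(a + 2bρ̄)`. The inter-bilayer pattern keeps its kinematic row `≥ −|t⊥'|` (sharp class constant of the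
parent). Exact dimer energies per unit `|t⊥|` at `V = W/|t⊥|`: `E₀(k) = 0, −1, (V − √(V²+16))/2, V − 1, 2V` (`k = 0..4`);
kernel-certified floor tables at `V ∈ {0, 2, 4, 8}` are in the tree (`Certificates/HubbardDimer_openBox2x1_sectorFloors`),
e.g. the chord through `k = 1, 2` at `V = 4` floors dimer fillings `2ρ ∈ [1, 2]` by `−1.1717 + 0.1716 k`, i.e. an allowance
`0.436·|t⊥|` per site at `ρ = 7/8` against the kinematic `|t⊥|`, at the price of reading the in-plane floor at `U − 4|t⊥|`.

* §1 `le_re_expect_localHamiltonian_pair_of_rows` (`a + b(ρ_0 + ρ_{e₀}) ≤ Re ω(h)` for every state) and the dressed row per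
  site `mul_cellEnergy_onSite_add_mul_cellEnergy_intraPattern_ge` (`½(a + 2bρ̄) ≤ W·D̄ + t⊥·K⊥`).
* §2 THE DRESSED FLOOR: `cellEnergy_inPlaneModel_eq_sub_add` (the `U`-split of the in-plane cell energy),
  `IsPeriodic.le_cellEnergy_periodicLayeredViews_dimer` (every period-2 state), **`le_infCellEnergyOn_periodicLayeredViews_dimer`**
  (the class infimum; general in-plane one-band model on `ℤ^d`) and the `t–t'` crystal on `ℤ³`
  **`le_infCellEnergyOn_bilayerHubbardTTPrime_dimer`**: `energyDensityTT' t t' (U − W) ρ + (a/2 + bρ) − |t⊥'| ≤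
  inf_{periodic, filling ρ} e(bilayer t–t'–t⊥–t⊥'–U crystal)` (`0 ≤ U − W`, `0 < ρ < 2`), rows on
  `groundEnergyAt (polyGraph {0, 0 + e₀}) t⊥ W`.
* §3 the rows' object is the open `2 × 1` cluster: `groundEnergyAt_polyGraph_pair_eq_openBox` (graph isomorphism with
  `hubbardOpenBoxTT' 2 1 t⊥ 0 W`, whose sector floors are kernel-certified) and `le_infCellEnergyOn_bilayerHubbardTTPrime_dimer_openBox`.
* §4 homogeneity: `hubbardOpenBoxTT'_smul`, `mul_groundEnergy_le_groundEnergy_smul` (`c·E₀(H,N) ≤ E₀(c·H,N)`, `c ≥ 0`),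
  `dimer_rows_smul` (unit-hopping tables serve every `t⊥`), and **`le_infCellEnergyOn_bilayerHubbardTTPrime_dimer_unitRows`**:
  `energyDensityTT' t t' (U − V t⊥) ρ + t⊥(a/2 + bρ) − |t⊥'| ≤ inf …` from unit rows at `V`.

Everything is PROVED; no definition, no named fact, no number of record. HONEST SCOPE: energy words only (variational cell energies
over the period-2 periodic class of the parent); one-sided (a FLOOR rule: the price of reading the in-plane floor at `U − W` is the
consumer's choice of `W`); the inter-bilayer class stays kinematic (its dressed twin is the same argument on the translated state);
nothing certifies a number about a material, and no phase word.

## Tree / Mathlib search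

REUSED: everything of `PeriodicLayeredLatticeBilayerCell` (§1–§3); `periodicLayeredViews`, `inPlaneModel`,
`abs_cellEnergy_sublatticeVectorHoppingViews_le_div`, `IsPeriodic.tiGroundEnergyDensityAt_sub_le_cellEnergy_periodicLayeredViews`,
`periodicLayeredHubbardTTPrimeViews` (`PeriodicLayeredLatticeEnergyTransport`); `layeredModel`, `ttPrimeVec(_ne_zero/_mem_thicken_one)`, `ttPrimeAmp`,
`hubbardTTPrimeFermionInteraction_eq_vectorHoppingModel`, `stack(_isTranslationInvariant)`, `density_stack` (`LayeredLatticeEnergyTransport`);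
`cellEnergy_viewFamily`, `cellEnergy_const`, `le_infCellEnergyOn`, `periodicStatesAt` (`SuperlatticeCellEnergyFamilies`);
`hubbardFermionInteraction_localHamiltonian`; `sum_re_expect_numberProj(_mul_groundEnergyAt_le)`, `sum_mul_re_expect_numberProj`,
`re_expect_numberProj_nonneg` (`HubbardStateSectorDecomposition`); `groundEnergyAt_eq_of_iso`, `hubbardOpenBoxTT'`, `rectBoxGraph`, `polyGraph_adj`,
`zdGraph_adj_iff`, `groundEnergySet_nonempty`, `groundEnergy_le_re_expect`, `card_orb`; `tiGroundEnergyDensityAt_hubbardTTPrime_eq_energyDensityTT'`,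
`exists_isTranslationInvariant_density_eq`. Mathlib: `Fintype.equivOfCardEq`, `Fintype.card_lex`, `Matrix.smul_mulVec`, `le_csInf`.
`lean search 'dimer|bilayer.*dress|interlayer.*docc' --decl` (QuantumLattice): nothing of this kind.

## References

* P. W. Anderson, Phys. Rev. 83 (1951) 1260, eq. (2) (cluster decomposition lower bound). [cite: Anderson1951, eq. (2)]
* D. Ruelle, *Statistical Mechanics: Rigorous Results* (1969), §2.4 (sector decomposition of a state's energy). [cite: Ruelle1969, §2.4]
* O. Bratteli, A. Kishimoto, D. W. Robinson, CMP 64 (1978) 41, Thm. 2 (variational principle). [cite: BratteliKishimotoRobinson1978, Thm. 2 (condition 2)]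
* J. P. F. LeBlanc et al., PRX 5 (2015) 041041, eq. (1) (open clusters of the one-band model). [cite: LeBlancEtAl2015, eq. (1)]
* E. H. Lieb, arXiv:cond-mat/9311033, §2 (sector ground energies). [cite: arXiv9311033, §2]
* E. Pavarini et al., PRL 87 (2001) 047003, eq. (1) (one-band models of layered cuprates, `t⊥`). [cite: PavariniEtAl2001, eq. (1)]
-/

noncomputable section

namespace Literature.MathematicalPhysics.QuantumLattice

open Matrix Finset HubbardWave0 Literature.Probability.LatticeModels ThermodynamicLimit
open scoped ComplexOrder BigOperators

/-! ### §1. The dimer's sector floor in a state, and the dressed row per site -/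

section Dimer

variable {d : ℕ}

/-- **THE DIMER'S SECTOR FLOOR IN A STATE.** If `a + b·k ≤ E₀(h, k)` for `k ≤ 4`, `h` the Hubbard dimer Hamiltonian
`hamiltonian (polyGraph {0, 0 + e₀}) s W` (sector ground energies `groundEnergyAt`), then for every state
`a + b·(ρ_0(ω) + ρ_{e₀}(ω)) ≤ Re ω(h)` (Ruelle's sector decomposition with `Σ_N p_N = 1`, `Σ_N N p_N = Re ω(N)`).
[cite: Ruelle1969, §2.4] -/
theorem InfVolFermionState.le_re_expect_localHamiltonian_pair_of_rows (ω : InfVolFermionState (d + 1)) (s W : ℝ)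
    {a b : ℝ}
    (hrow : ∀ k : ℕ, k ≤ 4 → a + b * k ≤ groundEnergyAt (polyGraph ({0, 0 + unitVec 0} : Finset (Site (d + 1)))) s W k) :
    a + b * (ω.density + (ω.expect {0 + unitVec 0} (nAt (0 + unitVec 0 : Site (d + 1)) (mem_singleton_self _) 0 +
        nAt (0 + unitVec 0) (mem_singleton_self _) 1)).re) ≤
      (ω.expect {0, 0 + unitVec 0}
        ((hubbardFermionInteraction (d + 1) s W).localHamiltonian {0, 0 + unitVec 0})).re := by
  set Λ : Finset (Site (d + 1)) := {0, 0 + unitVec 0} with hΛ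
  have h1 := ω.sum_re_expect_numberProj_mul_groundEnergyAt_le Λ (polyGraph Λ) s W
  rw [← hubbardFermionInteraction_localHamiltonian] at h1
  have hp1 := ω.sum_re_expect_numberProj Λ
  have hpN := ω.sum_mul_re_expect_numberProj Λ
  rw [ω.re_expect_totalNumber_pair] at hpN
  have hcard : Fintype.card (Orb (PolySite Λ)) = 4 := card_orb_polySite_pair
  refine le_trans ?_ h1
  calc a + b * (ω.density + (ω.expect {0 + unitVec 0} (nAt (0 + unitVec 0 : Site (d + 1)) (mem_singleton_self _) 0 +
        nAt (0 + unitVec 0) (mem_singleton_self _) 1)).re)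
      = ∑ N ∈ range (Fintype.card (Orb (PolySite Λ)) + 1), (ω.expect Λ (numberProj N)).re * (a + b * N) := by
        have hexp : ∀ N : ℕ, (ω.expect Λ (numberProj N)).re * (a + b * N) =
            a * (ω.expect Λ (numberProj N)).re + b * ((N : ℝ) * (ω.expect Λ (numberProj N)).re) := fun N => by ring
        simp_rw [hexp]
        rw [Finset.sum_add_distrib, ← Finset.mul_sum, ← Finset.mul_sum, hp1, hpN, mul_one]
    _ ≤ ∑ N ∈ range (Fintype.card (Orb (PolySite Λ)) + 1), (ω.expect Λ (numberProj N)).re * groundEnergyAt (polyGraph Λ) s W N :=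
        Finset.sum_le_sum fun N hN => by
          rw [hcard, mem_range, Nat.lt_succ_iff] at hN
          exact mul_le_mul_of_nonneg_left (hrow N hN) (ω.re_expect_numberProj_nonneg _ N)

/-- **THE DRESSED DIMER ROW, per site.** For every state `ω` of `ℤ^{d+1}` and all `s, W`: if `a + b·k ≤ E₀(h_dimer(s, W), k)`
(`k ≤ 4`), then `½(a + 2b·ρ̄(ω)) ≤ W·D̄(ω) + s·K⊥(ω)` — `D̄` the cell energy of the unit on-site repulsion, `K⊥` the cell
energy of the unit intra-bilayer pattern, `ρ̄` the cell filling (period-`2` stacking cell), range `R ≥ 1`.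
[cite: Anderson1951, eq. (2)] -/
theorem InfVolFermionState.mul_cellEnergy_onSite_add_mul_cellEnergy_intraPattern_ge (ω : InfVolFermionState (d + 1))
    (s W : ℝ) {R : ℝ} (hR : 1 ≤ R) {a b : ℝ}
    (hrow : ∀ k : ℕ, k ≤ 4 → a + b * k ≤ groundEnergyAt (polyGraph ({0, 0 + unitVec 0} : Finset (Site (d + 1)))) s W k) :
    2⁻¹ * (a + 2 * b * ω.cellFilling (stackPeriods d 1)) ≤
      W * ω.cellEnergy (fun _ : Cell (stackPeriods d 1) => hubbardFermionInteraction (d + 1) 0 1) R +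
        s * ω.cellEnergy (sublatticeVectorHoppingViews (stackPeriods d 1) (layerCoset d 0) (unitVec 0) 1) R := by
  have h := ω.le_re_expect_localHamiltonian_pair_of_rows s W hrow
  rw [ω.re_expect_localHamiltonian_pair s W] at h
  rw [ω.cellEnergy_const_stack_two, ω.cellEnergy_intraPattern_stack_two hR, ω.cellFilling_stack_two,
    ω.meanEnergy_onSite_eq_mul_re_expect_docc 1 hR, (ω.shift (unitVec 0)).meanEnergy_onSite_eq_mul_re_expect_docc 1 hR,
    ω.re_expect_docc_shift (unitVec 0), ω.density_shift_eq (unitVec 0), one_mul, one_mul]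
  linarith

end Dimer

/-! ### §2. THE DRESSED BILAYER FLOOR -/

section Floor

variable {d : ℕ} {ι : Type*} [Fintype ι]

/-- The vertical unit vector of `ℤ^{d+1}` points across the layers and lies in the unit range box. [folklore] -/
private theorem unitVec_zero_apply_zero_ne_zero_and_mem (d : ℕ) :
    (unitVec (0 : Fin (d + 1)) : Site (d + 1)) 0 ≠ 0 ∧
      (unitVec (0 : Fin (d + 1)) : Site (d + 1)) ∈ thicken ({0} : Finset (Site (d + 1))) 1 :=
  ⟨by simp [unitVec], unitVec_mem_thicken_one 0⟩

/-- **THE `U`-SPLIT OF THE IN-PLANE CELL ENERGY**: `e_{(inPlane U)}(ω) = e_{(inPlane (U−W))}(ω) + W·D̄(ω)` (constant views over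
any stacking cell; every state; `R ≥ 1`). [cite: PavariniEtAl2001, eq. (1)] -/
theorem InfVolFermionState.cellEnergy_inPlaneModel_eq_sub_add (ω : InfVolFermionState (d + 1)) {p : ℕ} (U W : ℝ)
    (u : ι → Site d) (θ : ι → ℝ) {R : ℝ} (hR : 1 ≤ R) :
    ω.cellEnergy (fun _ : Cell (stackPeriods d p) => inPlaneModel U u θ) R =
      ω.cellEnergy (fun _ : Cell (stackPeriods d p) => inPlaneModel (U - W) u θ) R +
        W * ω.cellEnergy (fun _ : Cell (stackPeriods d p) => hubbardFermionInteraction (d + 1) 0 1) R := by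
  rw [ω.cellEnergy_const, ω.cellEnergy_const, ω.cellEnergy_const, inPlaneModel, inPlaneModel, layeredModel, layeredModel,
    (ω.cellAverage (stackPeriods d p)).meanEnergy_vectorHoppingModel_eq_sub_add_onSite U W _ _ hR,
    (ω.cellAverage (stackPeriods d p)).meanEnergy_onSite_eq_mul_one W hR]

/-- **THE DRESSED FLOOR FOR EVERY PERIOD-2 STATE.** Period-`2` stacking of the one-band model (`U`, hoppings `θ_a` along
`u_a` in `ℤ^d`) with vertical bonds `e₀`: intra-bilayer amplitude `t⊥` from the even layers, inter-bilayer `t⊥'` from the odd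
layers. For every `(2, 1, …, 1)`-periodic state `ω` of cell filling `ρ`, every `W` and every dimer row `a + b k ≤ E₀(h_dimer(t⊥, W), k)`
(`k ≤ 4`): `e_ρ(one-band, U − W) + ½(a + 2bρ) − |t⊥'| ≤ e_cell(ω)`. [cite: Anderson1951, eq. (2)] -/
theorem InfVolFermionState.IsPeriodic.le_cellEnergy_periodicLayeredViews_dimer {ω : InfVolFermionState (d + 1)}
    (hω : ω.IsPeriodic (stackPeriods d 1)) {ρ : ℝ} (hρ : ω.cellFilling (stackPeriods d 1) = ρ) (U W : ℝ)
    {u : ι → Site d} (hu : ∀ a, u a ≠ 0) (θ : ι → ℝ) (tperp tperp' : ℝ) {R R' : ℝ} (hR : 1 ≤ R) (hRR' : R ≤ R')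
    (huR : ∀ a, u a ∈ thicken ({0} : Finset (Site d)) R) {a b : ℝ}
    (hrow : ∀ k : ℕ, k ≤ 4 → a + b * k ≤ groundEnergyAt (polyGraph ({0, 0 + unitVec 0} : Finset (Site (d + 1)))) tperp W k) :
    (vectorHoppingModel (U - W) u θ).tiGroundEnergyDensityAt R ρ + 2⁻¹ * (a + 2 * b * ρ) - |tperp'| ≤
      ω.cellEnergy (periodicLayeredViews 1 U u θ (fun _ : Fin 1 => (unitVec (0 : Fin (d + 1)) : Site (d + 1)))
        fun j _ => ![tperp, tperp'] j) R' := by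
  have hR' : 1 ≤ R' := hR.trans hRR'
  obtain ⟨hw0, hw1⟩ := unitVec_zero_apply_zero_ne_zero_and_mem d
  have hw : (unitVec (0 : Fin (d + 1)) : Site (d + 1)) ≠ 0 := uvec_ne_zero 0
  have hwR' : (unitVec (0 : Fin (d + 1)) : Site (d + 1)) ∈ thicken ({0} : Finset (Site (d + 1))) R' := thicken_mono _ hR' hw1
  -- (1) the in-plane floor at `U − W` (the parent's floor with all interlayer amplitudes `0`)
  have hin := hω.tiGroundEnergyDensityAt_sub_le_cellEnergy_periodicLayeredViews hρ (U - W) hu θ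
    (w := fun _ : Fin 1 => (unitVec (0 : Fin (d + 1)) : Site (d + 1))) (fun _ => hw) (fun _ _ => (0 : ℝ)) hR hRR' huR
    (fun _ => hwR')
  rw [periodicLayeredViews, InfVolFermionState.cellEnergy_viewFamily] at hin
  simp only [abs_zero, Finset.sum_const_zero, mul_zero, sub_zero, zero_mul, add_zero] at hin
  -- (2) the view-family expansion at `U`, the `U`-split and the two patterns
  have hsum : ∑ jb : Fin (1 + 1) × Fin 1, (fun j (_ : Fin 1) => (![tperp, tperp'] : Fin (1 + 1) → ℝ) j) jb.1 jb.2 *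
      ω.cellEnergy (sublatticeVectorHoppingViews (stackPeriods d 1) (layerCoset d jb.1)
        ((fun _ : Fin 1 => (unitVec (0 : Fin (d + 1)) : Site (d + 1))) jb.2) 1) R' =
      tperp * ω.cellEnergy (sublatticeVectorHoppingViews (stackPeriods d 1) (layerCoset d 0) (unitVec 0) 1) R' +
        tperp' * ω.cellEnergy (sublatticeVectorHoppingViews (stackPeriods d 1) (layerCoset d 1) (unitVec 0) 1) R' := by
    rw [Fintype.sum_prod_type]
    simp [Fin.sum_univ_two]
  rw [periodicLayeredViews, InfVolFermionState.cellEnergy_viewFamily, hsum, ω.cellEnergy_inPlaneModel_eq_sub_add U W u θ hR']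
  -- (3) the dimer row for the intra-bilayer class
  have hdimer := ω.mul_cellEnergy_onSite_add_mul_cellEnergy_intraPattern_ge tperp W hR' hrow
  rw [hρ] at hdimer
  -- (4) the kinematic row for the inter-bilayer class (sharp class constant `2/|cell| = 1`)
  have hK := abs_cellEnergy_sublatticeVectorHoppingViews_le_div (stackPeriods d 1) (layerCoset d 1) hw 1 hwR' ω
  rw [abs_one, mul_one, card_cell_stackPeriods, Nat.cast_add, Nat.cast_one, one_add_one_eq_two, div_self two_ne_zero] at hK
  have hK' : -|tperp'| ≤ tperp' * ω.cellEnergy (sublatticeVectorHoppingViews (stackPeriods d 1) (layerCoset d 1) (unitVec 0) 1) R' := by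
    have : |tperp' * ω.cellEnergy (sublatticeVectorHoppingViews (stackPeriods d 1) (layerCoset d 1) (unitVec 0) 1) R'| ≤ |tperp'| := by
      rw [abs_mul]; exact mul_le_of_le_one_right (abs_nonneg _) hK
    exact (abs_le.1 this).1
  linarith

/-- **THE DRESSED BILAYER FLOOR (class infimum).** Over the period-`2` periodic states of cell filling `ρ` (the class is
non-empty as soon as `ρ` is the density of a translation-invariant state of `ℤ^d`, `0 < d`), for every `W` and every dimer row
`a + b k ≤ E₀(h_dimer(t⊥, W), k)` (`k ≤ 4`):
`e_ρ(one-band on ℤ^d, U − W) + ½(a + 2bρ) − |t⊥'| ≤ inf_{periodic, filling ρ} e(period-2 stacked crystal)`.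
[cite: BratteliKishimotoRobinson1978, Thm. 2 (condition 2)] -/
theorem le_infCellEnergyOn_periodicLayeredViews_dimer (hd : 0 < d) {ρ : ℝ}
    (hne : ∃ ω₀ : InfVolFermionState d, ω₀.IsTranslationInvariant ∧ ω₀.density = ρ) (U W : ℝ)
    {u : ι → Site d} (hu : ∀ a, u a ≠ 0) (θ : ι → ℝ) (tperp tperp' : ℝ) {R R' : ℝ} (hR : 1 ≤ R) (hRR' : R ≤ R')
    (huR : ∀ a, u a ∈ thicken ({0} : Finset (Site d)) R) {a b : ℝ}
    (hrow : ∀ k : ℕ, k ≤ 4 → a + b * k ≤ groundEnergyAt (polyGraph ({0, 0 + unitVec 0} : Finset (Site (d + 1)))) tperp W k) :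
    (vectorHoppingModel (U - W) u θ).tiGroundEnergyDensityAt R ρ + 2⁻¹ * (a + 2 * b * ρ) - |tperp'| ≤
      infCellEnergyOn (periodicStatesAt (stackPeriods d 1) ρ)
        (periodicLayeredViews 1 U u θ (fun _ : Fin 1 => (unitVec (0 : Fin (d + 1)) : Site (d + 1)))
          fun j _ => ![tperp, tperp'] j) R' := by
  obtain ⟨ω₀, hω₀, hρ₀⟩ := hne
  have he := hω₀.isEven hd
  have hTI := InfVolFermionState.stack_isTranslationInvariant hω₀ he
  have hmem : ω₀.stack he ∈ periodicStatesAt (stackPeriods d 1) ρ :=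
    ⟨hTI.isPeriodic _, by rw [hTI.cellFilling_eq, InfVolFermionState.density_stack, hρ₀]⟩
  exact le_infCellEnergyOn _ R' ⟨_, hmem⟩ fun ω hω =>
    hω.1.le_cellEnergy_periodicLayeredViews_dimer hω.2 U W hu θ tperp tperp' hR hRR' huR hrow

/-- **THE DRESSED FLOOR FOR BILAYER `t–t'` HUBBARD CRYSTALS on `ℤ³`** (stacking period `2`; intra-bilayer `t⊥` from the even
layers, inter-bilayer `t⊥'` from the odd layers; `0 ≤ U − W`, `0 < ρ < 2`): for every dimer row `a + b k ≤ E₀(h_dimer(t⊥, W), k)`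
(`k ≤ 4`),
`energyDensityTT' t t' (U − W) ρ + (a/2 + bρ) − |t⊥'| ≤ inf_{periodic, cell filling ρ} e(bilayer crystal)` —
the twin of `infCellEnergyOn_bilayerHubbardTTPrime_mem_Icc` (floor `energyDensityTT' t t' U ρ − (|t⊥| + |t⊥'|)`) with the
intra-bilayer class priced by the Hubbard dimer at `(t⊥, W)` instead of its norm.
[cite: BratteliKishimotoRobinson1978, Thm. 2 (condition 2)] -/
theorem le_infCellEnergyOn_bilayerHubbardTTPrime_dimer (t t' : ℝ) {U W : ℝ} (hUW : 0 ≤ U - W) {ρ : ℝ} (hρ0 : 0 < ρ)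
    (hρ2 : ρ < 2) (tperp tperp' : ℝ) {a b : ℝ}
    (hrow : ∀ k : ℕ, k ≤ 4 → a + b * k ≤ groundEnergyAt (polyGraph ({0, 0 + unitVec 0} : Finset (Site 3))) tperp W k) :
    energyDensityTT' t t' (U - W) ρ + 2⁻¹ * (a + 2 * b * ρ) - |tperp'| ≤
      infCellEnergyOn (periodicStatesAt (stackPeriods 2 1) ρ)
        (periodicLayeredHubbardTTPrimeViews 1 t t' U (fun _ : Fin 1 => (unitVec (0 : Fin 3) : Site 3))
          fun j _ => ![tperp, tperp'] j) 1 := by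
  rw [← tiGroundEnergyDensityAt_hubbardTTPrime_eq_energyDensityTT' t t' hUW hρ0 hρ2,
    hubbardTTPrimeFermionInteraction_eq_vectorHoppingModel]
  exact le_infCellEnergyOn_periodicLayeredViews_dimer two_pos (exists_isTranslationInvariant_density_eq hρ0 hρ2) U W
    ttPrimeVec_ne_zero (ttPrimeAmp t t') tperp tperp' le_rfl le_rfl ttPrimeVec_mem_thicken_one hrow

end Floor

/-! ### §3. The rows' object is the open `2 × 1` cluster `hubbardOpenBoxTT' 2 1 t⊥ 0 W` -/

section Bridge

variable {d : ℕ}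

/-- In the induced graph of the two-point region `{0, 0 + e₀}` the two (distinct) sites are adjacent: adjacency is
`≠`. [folklore] -/
private theorem polyGraph_pair_adj_iff (x y : PolySite ({0, 0 + unitVec 0} : Finset (Site (d + 1)))) :
    (polyGraph ({0, 0 + unitVec 0} : Finset (Site (d + 1)))).Adj x y ↔ x ≠ y := by
  constructor
  · exact fun h => (polyGraph _).ne_of_adj h
  · intro hne
    rw [polyGraph_adj, zdGraph_adj_iff]
    have hx := PolySite.ofLex_mem x
    have hy := PolySite.ofLex_mem y
    rw [mem_insert, mem_singleton] at hx hy
    have hxy : ofLex x.1 ≠ ofLex y.1 := fun h => hne (Subtype.ext (ofLex.injective h))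
    rcases hx with hx | hx <;> rcases hy with hy | hy
    · exact absurd (hx.trans hy.symm) hxy
    · exact ⟨0, Or.inl (by rw [hx, hy])⟩
    · exact ⟨0, Or.inr (by rw [hx, hy])⟩
    · exact absurd (hx.trans hy.symm) hxy

/-- In the open `2 × 1` cluster the two (distinct) sites are adjacent: adjacency is `≠`. [folklore] -/
private theorem rectBoxGraph_two_one_adj_iff (p q : Fin 2 ×ₗ Fin 1) : (rectBoxGraph 2 1).Adj p q ↔ p ≠ q := by
  have key : ∀ a b : Fin 2 × Fin 1, (rectBoxGraph 2 1).Adj (toLex a) (toLex b) ↔ a ≠ b := by decide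
  have h := key (ofLex p) (ofLex q)
  rw [toLex_ofLex, toLex_ofLex] at h
  exact h.trans ofLex_inj.not

/-- **The dimer rows' object is the open `2 × 1` cluster**: the sector ground energies of the Hubbard Hamiltonian of the
induced graph on `{0, 0 + e₀} ⊆ ℤ^{d+1}` (hopping `s`, repulsion `W`) are those of `hubbardOpenBoxTT' 2 1 s 0 W`
(graph isomorphism: both graphs are one edge). [cite: LeBlancEtAl2015, eq. (1)] -/
theorem groundEnergyAt_polyGraph_pair_eq_openBox (s W : ℝ) (k : ℕ) :
    groundEnergyAt (polyGraph ({0, 0 + unitVec 0} : Finset (Site (d + 1)))) s W k =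
      groundEnergy (hubbardOpenBoxTT' 2 1 s 0 W) k := by
  have hcard : Fintype.card (PolySite ({0, 0 + unitVec 0} : Finset (Site (d + 1)))) = Fintype.card (Fin 2 ×ₗ Fin 1) := by
    rw [card_polySite, card_pair (self_ne_add_of_ne_zero 0 (uvec_ne_zero 0)), Fintype.card_lex, Fintype.card_prod,
      Fintype.card_fin, Fintype.card_fin]
  have hopen : hubbardOpenBoxTT' 2 1 s 0 W = hamiltonian (rectBoxGraph 2 1) s W := by
    simp [hubbardOpenBoxTT', hamiltonian]
  rw [hopen]
  exact (groundEnergyAt_eq_of_iso (polyGraph _) (rectBoxGraph 2 1) (Fintype.equivOfCardEq hcard)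
    (fun x y => by rw [rectBoxGraph_two_one_adj_iff, polyGraph_pair_adj_iff, (Fintype.equivOfCardEq hcard).injective.ne_iff])
    s W k).symm

/-- **THE DRESSED BILAYER FLOOR, rows on the open `2 × 1` cluster** (the form in which the dimer's sector floors are
kernel-certified): for `0 ≤ U − W`, `0 < ρ < 2` and every row `a + b k ≤ E₀(hubbardOpenBoxTT' 2 1 t⊥ 0 W, k)` (`k ≤ 4`),
`energyDensityTT' t t' (U − W) ρ + (a/2 + bρ) − |t⊥'| ≤ inf_{periodic, cell filling ρ} e(bilayer t–t' crystal)`.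
[cite: Anderson1951, eq. (2)] -/
theorem le_infCellEnergyOn_bilayerHubbardTTPrime_dimer_openBox (t t' : ℝ) {U W : ℝ} (hUW : 0 ≤ U - W) {ρ : ℝ}
    (hρ0 : 0 < ρ) (hρ2 : ρ < 2) (tperp tperp' : ℝ) {a b : ℝ}
    (hrow : ∀ k : ℕ, k ≤ 4 → a + b * k ≤ groundEnergy (hubbardOpenBoxTT' 2 1 tperp 0 W) k) :
    energyDensityTT' t t' (U - W) ρ + 2⁻¹ * (a + 2 * b * ρ) - |tperp'| ≤
      infCellEnergyOn (periodicStatesAt (stackPeriods 2 1) ρ)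
        (periodicLayeredHubbardTTPrimeViews 1 t t' U (fun _ : Fin 1 => (unitVec (0 : Fin 3) : Site 3))
          fun j _ => ![tperp, tperp'] j) 1 :=
  le_infCellEnergyOn_bilayerHubbardTTPrime_dimer t t' hUW hρ0 hρ2 tperp tperp' fun k hk => by
    rw [groundEnergyAt_polyGraph_pair_eq_openBox]; exact hrow k hk

end Bridge

/-! ### §4. Homogeneity of the dimer rows: unit-hopping tables serve every `t⊥` -/

section Scaling

/-- **Homogeneity of the open-cluster Hamiltonian**: `h_{a×b}(ct, ct', cU) = c · h_{a×b}(t, t', U)`. [cite: LeBlancEtAl2015, eq. (1)] -/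
theorem hubbardOpenBoxTT'_smul (a b : ℕ) (c t t' U : ℝ) :
    hubbardOpenBoxTT' a b (c * t) (c * t') (c * U) = (c : ℂ) • hubbardOpenBoxTT' a b t t' U := by
  simp only [hubbardOpenBoxTT', hamiltonian, Complex.ofReal_mul, Complex.ofReal_zero, smul_add, smul_smul, zero_smul,
    add_zero, mul_neg]

/-- **Scaling a Hamiltonian by `c ≥ 0` scales its sector ground energies from below**: `c·E₀(H, N) ≤ E₀(c·H, N)` on every
non-empty sector `N ≤ |ι|` (variational characterisation). [cite: arXiv9311033, §2] -/
theorem mul_groundEnergy_le_groundEnergy_smul {κ : Type*} [LinearOrder κ] [Fintype κ] (H : Matrix (Finset κ) (Finset κ) ℂ)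
    {c : ℝ} (hc : 0 ≤ c) {N : ℕ} (hN : N ≤ Fintype.card κ) :
    c * groundEnergy H N ≤ groundEnergy ((c : ℂ) • H) N := by
  refine le_csInf (groundEnergySet_nonempty _ hN) ?_
  rintro E ⟨ψ, hψN, hψ1, rfl⟩
  have h := groundEnergy_le_re_expect H hψN hψ1
  have hexp : (expect ((c : ℂ) • H) ψ).re = c * (expect H ψ).re := by
    rw [expect, expect, Matrix.smul_mulVec, dotProduct_smul, smul_eq_mul, Complex.re_ofReal_mul]
  rw [hexp]
  exact mul_le_mul_of_nonneg_left h hc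

/-- **Unit-hopping dimer rows serve every intra-bilayer amplitude**: rows `a + b k ≤ E₀(h_{2×1}(1, 0, V), k)` (`k ≤ 4`)
give, for every `c ≥ 0`, the rows `c·a + c·b·k ≤ E₀(h_{2×1}(c, 0, c·V), k)` — the dimer at hopping `c` and repulsion `c·V`.
[cite: LeBlancEtAl2015, eq. (1)] -/
theorem dimer_rows_smul {a b V c : ℝ} (hc : 0 ≤ c)
    (hrow : ∀ k : ℕ, k ≤ 4 → a + b * k ≤ groundEnergy (hubbardOpenBoxTT' 2 1 1 0 V) k) :
    ∀ k : ℕ, k ≤ 4 → c * a + c * b * k ≤ groundEnergy (hubbardOpenBoxTT' 2 1 c 0 (c * V)) k := by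
  intro k hk
  have hN : k ≤ Fintype.card (Orb (Fin 2 ×ₗ Fin 1)) := by
    rw [card_orb, Fintype.card_lex, Fintype.card_prod, Fintype.card_fin, Fintype.card_fin]; omega
  have hs : hubbardOpenBoxTT' 2 1 c 0 (c * V) = (c : ℂ) • hubbardOpenBoxTT' 2 1 1 0 V := by
    have h := hubbardOpenBoxTT'_smul 2 1 c 1 0 V
    rwa [mul_one, mul_zero] at h
  rw [hs]
  calc c * a + c * b * k = c * (a + b * k) := by ring
    _ ≤ c * groundEnergy (hubbardOpenBoxTT' 2 1 1 0 V) k := mul_le_mul_of_nonneg_left (hrow k hk) hc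
    _ ≤ _ := mul_groundEnergy_le_groundEnergy_smul _ hc hN

/-- **THE DRESSED BILAYER FLOOR from a unit-hopping dimer table**: for `t⊥ ≥ 0`, `0 ≤ U − V·t⊥`, `0 < ρ < 2` and unit rows
`a + b k ≤ E₀(h_{2×1}(1, 0, V), k)` (`k ≤ 4`),
`energyDensityTT' t t' (U − V t⊥) ρ + t⊥·(a/2 + bρ) − |t⊥'| ≤ inf_{periodic, cell filling ρ} e(bilayer t–t' crystal)`.
[cite: Anderson1951, eq. (2)] -/
theorem le_infCellEnergyOn_bilayerHubbardTTPrime_dimer_unitRows (t t' : ℝ) {U V tperp : ℝ} (htp : 0 ≤ tperp)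
    (hUW : 0 ≤ U - V * tperp) {ρ : ℝ} (hρ0 : 0 < ρ) (hρ2 : ρ < 2) (tperp' : ℝ) {a b : ℝ}
    (hrow : ∀ k : ℕ, k ≤ 4 → a + b * k ≤ groundEnergy (hubbardOpenBoxTT' 2 1 1 0 V) k) :
    energyDensityTT' t t' (U - V * tperp) ρ + tperp * (2⁻¹ * (a + 2 * b * ρ)) - |tperp'| ≤
      infCellEnergyOn (periodicStatesAt (stackPeriods 2 1) ρ)
        (periodicLayeredHubbardTTPrimeViews 1 t t' U (fun _ : Fin 1 => (unitVec (0 : Fin 3) : Site 3))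
          fun j _ => ![tperp, tperp'] j) 1 := by
  have h := le_infCellEnergyOn_bilayerHubbardTTPrime_dimer_openBox t t' (W := V * tperp) hUW hρ0 hρ2 tperp tperp'
    (a := tperp * a) (b := tperp * b) fun k hk => by
      have h' := dimer_rows_smul htp hrow k hk
      rwa [mul_comm tperp V] at h'
  have hlin : tperp * (2⁻¹ * (a + 2 * b * ρ)) = 2⁻¹ * (tperp * a + 2 * (tperp * b) * ρ) := by ring
  rw [hlin]
  exact h

end Scaling

end Literature.MathematicalPhysics.QuantumLattice

end
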